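import Literature.NumberTheory.LFunctions.WeilFirstPrimeCertificateDataC
import HarnessLib

/-!
# First-prime Weil positivity, stage C: kernel check of the cells, chunks 12, 13, 14

Part of `weilCert3C.check` (`WeilFirstPrimeCertificateDataC.lean`), evaluated by `decide +kernel` and kept in its own
file for kernel time and memory (each declaration is checked separately). Assembled in
`WeilFirstPrimeCertificateCCheck.lean`. Pure proof file; nothing is asserted.
-/

noncomputable section

namespace Literature.NumberTheory.LFunctions

set_option maxHeartbeats 0 in
/-- **Kernel check of the cells, chunk 12** of the stage-C first-prime certificate. [folklore] -/
theorem checkCellsChunk12_weilCert3C :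
    (weilCert3CCells12.all fun c ↦ c.checkZ 72 5) = true := by
  decide +kernel

set_option maxHeartbeats 0 in
/-- **Kernel check of the cells, chunk 13** of the stage-C first-prime certificate. [folklore] -/
theorem checkCellsChunk13_weilCert3C :
    (weilCert3CCells13.all fun c ↦ c.checkZ 72 5) = true := by
  decide +kernel

set_option maxHeartbeats 0 in
/-- **Kernel check of the cells, chunk 14** of the stage-C first-prime certificate. [folklore] -/
theorem checkCellsChunk14_weilCert3C :
    (weilCert3CCells14.all fun c ↦ c.checkZ 72 5) = true := by
  decide +kernel

end Literature.NumberTheory.LFunctions
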